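import Literature.NumberTheory.ComplexMultiplication.MainTheoremCMLevelKappaPoints
import Literature.NumberTheory.ComplexMultiplication.MainTheoremCMLevelUniformizationTransport
import HarnessLib

/-!
# Main theorem of complex multiplication — «`ξ(u)^σ = E(κ_ℂ(ξ₁(u)))`» for `u ∈ N⁻¹𝔞` (piece D2 of the level structure)

[Shimura1998] G. Shimura, *Abelian varieties with complex multiplication and modular functions* (1998), §18.6 proof of
Thm. 18.6, pp. 127–128 («`t^σ = κt` for every `t ∈ A[N]` … hence `ξ(u)^σ = ξ′(…)`», p. 128; the held text's chunk ids
p0167–p0168 are not pages).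

Topic: row II-1 S7a of the h21 programme, harness piece D2 «`κ = σ` on the `L₁`-rational `N`-torsion, READ IN `ℂ`»:
theorems only, no definition, no named fact.  From D1 («`κx = x^γ` for `x ∈ (A₀ ⊗ L₁)[N](L₁)`», the tree's
`map_eq_conjPoints_of_forall_prime`), the rationality of the `N`-torsion of `A₀ ⊗ ℂ` over `L₁` (`htors`, G2) and B-p09's
complex reading `conjPoints_eq_map_of_forall_torsion`, for the uniformisation `ξ` of `A₀ ⊗ ℂ` and its tower source `ξ₁`
on `(A₀ ⊗ L₁) ⊗ ℂ` (`ξ = T ∘ ξ₁`, `exists_tower_source`): for every `u ∈ K` with `N u ∈ 𝔞`,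
`(ξ u)^σ = E(κ_ℂ(ξ₁ u))` with `E = e₁ ≫ T^σ` — i.e. the hypothesis `hF`/`hFG` of the (2)_N transport
(`CMTypeUniformization.exists_reindex_forall_conj_eq_of_torsionCongruence_of_latticeIdentity`) with `F := conjPoints σ`
and `G := E ∘ κ_ℂ ∘ T⁻¹`.

## Main statements
* `CMTypeUniformization.map_inv_r_eq_of_forall_r_eq_map` — `ξ = T ∘ ξ₁ ⇒ T⁻¹ ∘ ξ = ξ₁`.
* `CMTypeUniformization.conjPoints_r_eq_of_forall_torsion` — THE D2 IDENTITY at `u ∈ N⁻¹𝔞`.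
* `CMTypeUniformization.conjPoints_eq_of_forall_torsion_on_torsionPoints` — the same as «`F = G` on `(A₀ ⊗ ℂ)[N](ℂ)`» (`hFG` shape).
-/

noncomputable section

open CategoryTheory CategoryTheory.Limits AlgebraicGeometry NumberField
open scoped NumberField nonZeroDivisors
open Literature.AlgebraicGeometry.Motives Literature.AlgebraicGeometry.Motives.AbelianVariety

namespace Literature.NumberTheory.ComplexMultiplication

variable {K : Type} [Field K] [NumberField K] {Φ : CMType K} {𝔞 : (FractionalIdeal (𝓞 K)⁰ K)ˣ}
variable {L L₁ : Type} [Field L] [Field L₁] [Algebra L L₁] [Algebra L₁ ℂ] [Algebra L ℂ] [IsScalarTower L L₁ ℂ]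
  (A₀ : AbelianVariety L) (ι₀ : 𝓞 K →+* End A₀) (γ : L₁ ≃+* L₁) (σ : ℂ ≃+* ℂ)
  (hσ : ∀ x : L₁, σ (algebraMap L₁ ℂ x) = algebraMap L₁ ℂ (γ x))

/-- `ξ = T ∘ ξ₁` on `K` ⇒ `T⁻¹(ξ u) = ξ₁ u` (for the tower source `ξ₁` of `exists_tower_source`).
[cite: Shimura1998, §18.6 proof of Thm. 18.6 (the diagram `ξ`/`η`/`ξ` with the isogenies `λ`, `μ`), p. 127] -/
theorem CMTypeUniformization.map_inv_r_eq_of_forall_r_eq_map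
    (ξ : CMTypeUniformization Φ 𝔞 (A₀.baseChange ℂ) ((endBaseChange ℂ A₀).comp ι₀))
    (ξ₁ : CMTypeUniformization Φ 𝔞 ((A₀.baseChange L₁).baseChange ℂ)
        ((endBaseChange ℂ (A₀.baseChange L₁)).comp ((endBaseChange L₁ A₀).comp ι₀)))
    (hξ₁ : ∀ x : K, ξ.r x = AlgPoints.map (baseChangeTowerIso L L₁ ℂ A₀).hom.hom.hom.hom (ξ₁.r x)) (u : K) :
    AlgPoints.map (baseChangeTowerIso L L₁ ℂ A₀).inv.hom.hom.hom (ξ.r u) = ξ₁.r u := by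
  rw [hξ₁ u, ← AlgPoints.map_comp_apply]
  have h : (baseChangeTowerIso L L₁ ℂ A₀).hom.hom.hom.hom ≫ (baseChangeTowerIso L L₁ ℂ A₀).inv.hom.hom.hom = 𝟙 _ :=
    congr_arg (fun f : (A₀.baseChange L₁).baseChange ℂ ⟶ (A₀.baseChange L₁).baseChange ℂ => f.hom.hom.hom)
      (baseChangeTowerIso L L₁ ℂ A₀).hom_inv_id
  rw [h, AlgPoints.map_id_apply]

/-- **D2: «`ξ(u)^σ = E(κ_ℂ(ξ₁(u)))`» for every `u ∈ N⁻¹𝔞`** — `κ = γ` on the `L₁`-rational `N`-torsion of the model (`hκ`,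
D1), the `N`-torsion of `A₀ ⊗ ℂ` is `L₁`-rational (`htors`, G2), `ξ = T ∘ ξ₁` (tower source); then `σ`-conjugation of the
`N`-torsion point `ξ(u)` is `E(κ_ℂ(ξ₁ u))` with `E = e₁ ≫ T^σ` (B-p09's `conjPoints_eq_map_of_forall_torsion` at `P := ξ u`).
[cite: Shimura1998, §18.6 proof of Thm. 18.6 (reduction modulo `𝔓`: «`t^σ = κt`»), pp. 127–128] -/
theorem CMTypeUniformization.conjPoints_r_eq_of_forall_torsion
    (ξ : CMTypeUniformization Φ 𝔞 (A₀.baseChange ℂ) ((endBaseChange ℂ A₀).comp ι₀))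
    (ξ₁ : CMTypeUniformization Φ 𝔞 ((A₀.baseChange L₁).baseChange ℂ)
        ((endBaseChange ℂ (A₀.baseChange L₁)).comp ((endBaseChange L₁ A₀).comp ι₀)))
    (hξ₁ : ∀ x : K, ξ.r x = AlgPoints.map (baseChangeTowerIso L L₁ ℂ A₀).hom.hom.hom.hom (ξ₁.r x))
    (κ : A₀.baseChange L₁ ⟶ (A₀.baseChange L₁).conjugate γ) (N : ℕ)
    (htors : ∀ P ∈ (A₀.baseChange ℂ).torsionPoints ℂ (N : ℤ), ∃ x : (A₀.baseChange L₁).Points L₁,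
      x ∈ (A₀.baseChange L₁).torsionPoints L₁ (N : ℤ) ∧
        AlgPoints.map (baseChangeTowerIso L L₁ ℂ A₀).hom.hom.hom.hom
          ((A₀.baseChange L₁).pointsMulEquiv ℂ (AlgPoints.extendScalars (A₀.baseChange L₁).X L₁ ℂ x)) = P)
    (hκ : ∀ x ∈ (A₀.baseChange L₁).torsionPoints L₁ (N : ℤ),
      AlgPoints.map κ.hom.hom.hom x = (A₀.baseChange L₁).conjPoints γ x)
    (u : K) (hu : (N : K) * u ∈ (𝔞 : FractionalIdeal (𝓞 K)⁰ K)) :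
    (A₀.baseChange ℂ).conjPoints σ (ξ.r u) =
      AlgPoints.map ((conjugateBaseChangeAlongIso γ σ hσ (A₀.baseChange L₁)).hom ≫
            Hom.conjugate σ (baseChangeTowerIso L L₁ ℂ A₀).hom).hom.hom.hom
        (AlgPoints.map (Hom.baseChange ℂ κ).hom.hom.hom (ξ₁.r u)) := by
  rw [← CMTypeUniformization.map_inv_r_eq_of_forall_r_eq_map A₀ ι₀ ξ ξ₁ hξ₁ u]
  exact AbelianVariety.conjPoints_eq_map_of_forall_torsion A₀ γ σ hσ κ (N : ℤ) htors hκ (ξ.r u)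
    (ξ.r_nsmul_mem N u hu)

/-- **D2 in the `hFG` shape** («`F = G` on `(A₀ ⊗ ℂ)[N](ℂ)`» with `F := conjPoints σ`, `G := E ∘ κ_ℂ ∘ T⁻¹` as ONE function on
points) — the input of `CMTypeUniformization.forall_conj_eq_of_eq_on_torsion` /
`exists_reindex_forall_conj_eq_of_torsionCongruence_of_latticeIdentity`; this is B-p09's `conjPoints_eq_map_of_forall_torsion`
with the hypotheses in the harness order.
[cite: Shimura1998, §18.6 proof of Thm. 18.6 (reduction modulo `𝔓`: «`t^σ = κt`»), pp. 127–128] -/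
theorem CMTypeUniformization.conjPoints_eq_of_forall_torsion_on_torsionPoints
    (κ : A₀.baseChange L₁ ⟶ (A₀.baseChange L₁).conjugate γ) (N : ℕ)
    (htors : ∀ P ∈ (A₀.baseChange ℂ).torsionPoints ℂ (N : ℤ), ∃ x : (A₀.baseChange L₁).Points L₁,
      x ∈ (A₀.baseChange L₁).torsionPoints L₁ (N : ℤ) ∧
        AlgPoints.map (baseChangeTowerIso L L₁ ℂ A₀).hom.hom.hom.hom
          ((A₀.baseChange L₁).pointsMulEquiv ℂ (AlgPoints.extendScalars (A₀.baseChange L₁).X L₁ ℂ x)) = P)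
    (hκ : ∀ x ∈ (A₀.baseChange L₁).torsionPoints L₁ (N : ℤ),
      AlgPoints.map κ.hom.hom.hom x = (A₀.baseChange L₁).conjPoints γ x) :
    ∀ P : (A₀.baseChange ℂ).Points ℂ, P ∈ (A₀.baseChange ℂ).torsionPoints ℂ (N : ℤ) →
      (A₀.baseChange ℂ).conjPoints σ P =
        (fun Q => AlgPoints.map ((conjugateBaseChangeAlongIso γ σ hσ (A₀.baseChange L₁)).hom ≫
              Hom.conjugate σ (baseChangeTowerIso L L₁ ℂ A₀).hom).hom.hom.hom
          (AlgPoints.map (Hom.baseChange ℂ κ).hom.hom.hom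
            (AlgPoints.map (baseChangeTowerIso L L₁ ℂ A₀).inv.hom.hom.hom Q))) P :=
  fun P hP => AbelianVariety.conjPoints_eq_map_of_forall_torsion A₀ γ σ hσ κ (N : ℤ) htors hκ P hP

end Literature.NumberTheory.ComplexMultiplication

end
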